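/-
# The currency bridge pv21 `BlkMaj` ⟷ block norms, and 43's decaying block letter FROM block majorants

Cell `pub-balaban-gaps`, seat **g1-p2 GEN 5** (prover), row **(D4)**.  §1 is LIFTED from planner g1-plan-1 GEN 15's
skeleton #14 (`pub-balaban-gaps-g1-plan-1/skel14_F_bridge_blkMaj_blockNorm.NOT-TO-FILE.lean`, sha16 6e82f42745a8a351,
farm rc 0, offered «lift freely» in [G1-PLAN1-G15-POINTER], INBOX l.1844): the prior cell's pv21 block-majorant currency
(`B9SectCDiffEstimate.BlkMaj`, the matrix form of `B6RandomWalk.HasMajorant`, in which the (3.42)-majorants of the local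
inverses are PRODUCED: `B9Thm37GlueSt` ∕ `B9Thm37GlueCor36`) and this cell's block currency (`D4WalkBlock.blockNorm`, the letter
shape of `D4WalkBlockLocalDecay.IsDomainLocalBD.hbdBD`) are EQUIVALENT on the entrywise-norm matrix — the (F)-half «currency
bridge» of plan-1's note 28 (J44-2) is near-definitional.  §2 adds what a junction needs on top: majorants of the
entrywise-norm matrix are MONOTONE and MULTIPLY (`normMat (S·T) ≤ normMat S · normMat T` entrywise, then `BlkMaj.mul`), so a
product family `K(h_□)·G′_□·h_□` inherits a majorant from its factors' majorants in pv21 currency; §3 is the CONSTRUCTOR of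
43's decaying block datum `IsDomainLocalBD` from block-majorant data (majorant dominated by `λ·e^{−ρD_□}` on the ball,
majorant vanishing off `dom □ × dom □`).  Complementary to an4's `Beta/RemainderDecay190BlockNorm` (p361308: the REAL-matrix ∕
real-part dictionary `HasMaj (ofBlocks) ⟺ blockNorm (A.map ofReal) ≤ K`); here complex matrices through `normMat`.
HONEST FRAMING: bookkeeping ∕ packaging; the majorant PRODUCTION for Bałaban's `G′_□(u)` at complex background (L-12's
J-2a-u★, [B9] Thm 3.15 p.432 «same way») is NOT here; (D4) instance 0∕1; NOT continuum, NOT Clay.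

References: T. Bałaban, Comm. Math. Phys. 99 (1985) 389–434 [B9], (3.42) p.399, Cor 3.6 p.408, (3.89) p.409, Thm 3.10 (3.108)
p.416; Comm. Math. Phys. 116 (1988) 1–22 [II], (1.11) p.5.
-/
import Summits.QuantumFields.BalabanUV.Gaps.D4WalkBlockLocalDecay
import Literature.MathematicalPhysics.QuantumFieldTheory.Balaban1983to89.B9SectCDiffEstimate

noncomputable section

namespace Summit.QuantumFields.BalabanUV.Gaps.D4WalkBlockMajorantBridge

open Metric Finset
open Literature.MathematicalPhysics.QuantumFieldTheory.Balaban1983to89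
open Literature.MathematicalPhysics.QuantumFieldTheory.Balaban1983to89.B9Thm37GlueTorus (tdist1)
open Literature.MathematicalPhysics.QuantumFieldTheory.Balaban1983to89.B5TorusCover (UT)
open Literature.MathematicalPhysics.QuantumFieldTheory.Balaban1983to89.B9SectCDiffEstimate (BlkMaj)
open Literature.MathematicalPhysics.QuantumFieldTheory.Balaban1983to89.B13DomainKernelWalks (DomainTerms)
open Summit.QuantumFields.BalabanUV.Gaps.D4WalkBlock
  (rowMass blockNorm rowMass_le_blockNorm blockNorm_le_of_rowMass_le blockNorm_nonneg)
open Summit.QuantumFields.BalabanUV.Gaps.D4WalkBlockLocalDecay (IsDomainLocalBD)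

variable {ν : ℕ} {K : Fin ν → ℕ}
variable {p n q : Type} [Fintype p] [Fintype n] [Fintype q]

/-! ## §1. The bridge (plan-1's skeleton #14): a block majorant of the entrywise-norm matrix IS a block-norm bound -/

/-- The entrywise-norm matrix of a complex matrix. [folklore] -/
def normMat (T : Matrix p n ℂ) : Matrix p n ℝ := Matrix.of fun i j => ‖T i j‖

omit [Fintype p] [Fintype n] in
/-- Entry formula. [folklore] -/
@[simp] theorem normMat_apply (T : Matrix p n ℂ) (i : p) (j : n) : normMat T i j = ‖T i j‖ := rfl

omit [Fintype p] [Fintype n] in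
/-- The entrywise-norm matrix is non-negative. [folklore] -/
theorem normMat_nonneg (T : Matrix p n ℂ) (i : p) (j : n) : 0 ≤ normMat T i j :=
  show 0 ≤ ‖T i j‖ from norm_nonneg _

variable (cub : p → UT K) (cubn : n → UT K) (cubq : q → UT K)

omit [Fintype p] in
/-- The row mass of `T` inside cube `y′` is the filtered block sum of `|normMat T|`. [folklore] -/
theorem rowMass_eq_sum_abs_normMat (T : Matrix p n ℂ) (i : p) (y' : UT K) :
    rowMass cubn T i y' = ∑ j ∈ univ.filter (fun j => cubn j = y'), |normMat T i j| := by
  unfold rowMass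
  refine Finset.sum_congr rfl fun j _ => ?_
  rw [normMat_apply, abs_of_nonneg (norm_nonneg _)]

/-- **BRIDGE, pv21 → block currency**: a block majorant of the entrywise-norm matrix is a block-norm bound. [folklore] -/
theorem blockNorm_le_of_blkMaj {T : Matrix p n ℂ} {Km : Matrix (UT K) (UT K) ℝ}
    (h : BlkMaj cub cubn (normMat T) Km) (y y' : UT K) : blockNorm cub cubn T y y' ≤ Km y y' := by
  refine blockNorm_le_of_rowMass_le cub cubn T y y' (h.nonneg y y') fun i hi => ?_
  rw [rowMass_eq_sum_abs_normMat, ← hi]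
  exact h.le i y'

/-- **BRIDGE, block currency → pv21**: a block-norm bound by a non-negative kernel is a block majorant of the entrywise-norm
matrix. [folklore] -/
theorem blkMaj_of_blockNorm_le {T : Matrix p n ℂ} {Km : Matrix (UT K) (UT K) ℝ} (hK : ∀ I J, 0 ≤ Km I J)
    (h : ∀ y y', blockNorm cub cubn T y y' ≤ Km y y') : BlkMaj cub cubn (normMat T) Km where
  nonneg := hK
  le i J := by
    rw [← rowMass_eq_sum_abs_normMat]
    exact (rowMass_le_blockNorm cub cubn T i J).trans (h (cub i) J)

/-- **THE CURRENCY BRIDGE IS AN EQUIVALENCE.** [folklore] -/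
theorem blkMaj_normMat_iff {T : Matrix p n ℂ} {Km : Matrix (UT K) (UT K) ℝ} :
    BlkMaj cub cubn (normMat T) Km ↔ (∀ I J, 0 ≤ Km I J) ∧ ∀ y y', blockNorm cub cubn T y y' ≤ Km y y' :=
  ⟨fun h => ⟨h.nonneg, blockNorm_le_of_blkMaj cub cubn h⟩, fun h => blkMaj_of_blockNorm_le cub cubn h.1 h.2⟩

/-- Read-off in the DECAYING letter shape of `IsDomainLocalBD.hbdBD`: a block majorant dominated by `λ·e^{−ρ·D(y,y′)}` gives
the decaying block letter. [cite: Balaban1985BackgroundPropagators, (3.42) p.399, (3.89) p.409] -/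
theorem blockNorm_le_exp_of_blkMaj {T : Matrix p n ℂ} {Km : Matrix (UT K) (UT K) ℝ} (h : BlkMaj cub cubn (normMat T) Km)
    {lam ρ : ℝ} {D : UT K → UT K → ℝ} (hdom : ∀ y y', Km y y' ≤ lam * Real.exp (-(ρ * D y y'))) (y y' : UT K) :
    blockNorm cub cubn T y y' ≤ lam * Real.exp (-(ρ * D y y')) :=
  (blockNorm_le_of_blkMaj cub cubn h y y').trans (hdom y y')

/-- A block majorant that VANISHES at `(y, y′)` kills the block. [folklore] -/
theorem blockNorm_eq_zero_of_blkMaj {T : Matrix p n ℂ} {Km : Matrix (UT K) (UT K) ℝ} (h : BlkMaj cub cubn (normMat T) Km)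
    {y y' : UT K} (h0 : Km y y' = 0) : blockNorm cub cubn T y y' = 0 :=
  le_antisymm (h0 ▸ blockNorm_le_of_blkMaj cub cubn h y y') (blockNorm_nonneg cub cubn T y y')

/-! ## §2. Majorants of entrywise-norm matrices are monotone and multiply -/

variable {cub cubn cubq}

omit [Fintype p] in
/-- Monotonicity: an entrywise smaller matrix has the same block majorants. [folklore] -/
theorem blkMaj_mono {T₁ T₂ : Matrix p n ℝ} {Km : Matrix (UT K) (UT K) ℝ} (hle : ∀ i j, |T₁ i j| ≤ |T₂ i j|)
    (h : BlkMaj cub cubn T₂ Km) : BlkMaj cub cubn T₁ Km where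
  nonneg := h.nonneg
  le i J := (Finset.sum_le_sum fun j _ => hle i j).trans (h.le i J)

omit [Fintype p] [Fintype q] in
/-- The entrywise-norm matrix of a product is below the product of the entrywise-norm matrices. [folklore] -/
theorem normMat_mul_le (S : Matrix p n ℂ) (T : Matrix n q ℂ) (i : p) (k : q) :
    normMat (S * T) i k ≤ (normMat S * normMat T) i k := by
  rw [normMat_apply, Matrix.mul_apply, Matrix.mul_apply]
  refine (norm_sum_le _ _).trans (le_of_eq (Finset.sum_congr rfl fun j _ => ?_))
  rw [norm_mul, normMat_apply, normMat_apply]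

omit [Fintype p] in
/-- **MAJORANTS MULTIPLY through the entrywise norm**: majorants `K_S`, `K_T` of `normMat S`, `normMat T` give the majorant
`K_S·K_T` of `normMat (S·T)` (`BlkMaj.mul` + monotonicity) — the socket for print's PRODUCT letter (3.89) of `K(h_□)G′_□h_□`
from its factors' (3.42)-majorants. [cite: Balaban1985BackgroundPropagators, (3.42) p.399, (3.89) p.409, Cor 3.8 p.410] -/
theorem blkMaj_normMat_mul {S : Matrix p n ℂ} {T : Matrix n q ℂ} {KS KT : Matrix (UT K) (UT K) ℝ}
    (hS : BlkMaj cub cubn (normMat S) KS) (hT : BlkMaj cubn cubq (normMat T) KT) :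
    BlkMaj cub cubq (normMat (S * T)) (KS * KT) :=
  blkMaj_mono (fun i k => by
    rw [abs_of_nonneg (normMat_nonneg _ i k), abs_of_nonneg (by
      rw [Matrix.mul_apply]; exact Finset.sum_nonneg fun j _ => mul_nonneg (normMat_nonneg S i j) (normMat_nonneg T j k))]
    exact normMat_mul_le S T i k) (hS.mul hT)

omit [Fintype p] in
/-- Majorants ADD through the entrywise norm. [folklore] -/
theorem blkMaj_normMat_add {S T : Matrix p n ℂ} {KS KT : Matrix (UT K) (UT K) ℝ}
    (hS : BlkMaj cub cubn (normMat S) KS) (hT : BlkMaj cub cubn (normMat T) KT) :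
    BlkMaj cub cubn (normMat (S + T)) (KS + KT) :=
  blkMaj_mono (fun i j => by
    rw [abs_of_nonneg (normMat_nonneg _ i j), abs_of_nonneg (by
      rw [Matrix.add_apply]; exact add_nonneg (normMat_nonneg S i j) (normMat_nonneg T i j))]
    rw [normMat_apply, Matrix.add_apply, Matrix.add_apply, normMat_apply, normMat_apply]
    exact norm_add_le _ _) (hS.add hT)

omit [Fintype p] in
/-- Majorants pass to SCALAR multiples through the entrywise norm (`|t| ≤ 1`: the s-decoration and partition factors).
[folklore] -/
theorem blkMaj_normMat_smul {T : Matrix p n ℂ} {Km : Matrix (UT K) (UT K) ℝ} (h : BlkMaj cub cubn (normMat T) Km)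
    {t : ℂ} (ht : ‖t‖ ≤ 1) : BlkMaj cub cubn (normMat (t • T)) Km :=
  blkMaj_mono (fun i j => by
    rw [abs_of_nonneg (normMat_nonneg _ i j), abs_of_nonneg (normMat_nonneg _ i j), normMat_apply, normMat_apply,
      Matrix.smul_apply, smul_eq_mul, norm_mul]
    exact mul_le_of_le_one_left (norm_nonneg _) ht) h

/-! ## §3. The constructor: 43's decaying block datum FROM block-majorant data -/

section Constructor

variable {d N' : ℕ} [∀ i, NeZero (K i)]
variable {E : Type*} [NormedAddCommGroup E] [NormedSpace ℂ E]
variable {L : DomainTerms d N' ν K p n E} {c : B13.Consts} {cub : p → UT K} {cubn : n → UT K} {X : Finset (UT K)}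
variable {R lam ρ r : ℝ} {mJ nD : ℕ}

/-- **`IsDomainLocalBD` FROM pv21-CURRENCY DATA.**  A domain skeleton whose coefficients `F_□(u)` carry, for every `u`, a block
majorant of `normMat (F_□(u))` VANISHING off `dom □ × dom □` (support), and for `u` in the `R`-ball one DOMINATED by
`λ·e^{−ρ·D_□(y,y′)}` (decay in the one-point distance), with holomorphic entries and the geometry letters `(r, m_J, n_D)` and the
σ-region condition, IS a decaying block datum of file 43 — whence (files 43/44/40) a `BlockWalkExpansion` with rate kept.  This is
the typed junction socket at which (3.42)-majorants produced in pv21 currency (`B9Thm37GlueSt`, `B9Thm37GlueCor36`) enter this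
cell's walk bookkeeping. [cite: Balaban1985BackgroundPropagators, (3.42) p.399, Cor 3.6 p.408, (3.89) p.409, Thm 3.10 (3.108) p.416; Balaban1988RG2Cluster, (1.11) p.5, p.13, p.15] -/
theorem isDomainLocalBD_of_blkMaj
    (hanchor : ∀ b, L.anchor b ∈ L.dom b)
    (hmajS : ∀ b u, ∃ Km : Matrix (UT K) (UT K) ℝ, BlkMaj cub cubn (normMat (L.op b u)) Km ∧
      ∀ y y', (y ∉ L.dom b ∨ y' ∉ L.dom b) → Km y y' = 0)
    (han : ∀ b i j, DifferentiableOn ℂ (fun u => L.op b u i j) (ball (0 : E) R))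
    (hmajD : ∀ b, ∀ u ∈ ball (0 : E) R, ∃ Km : Matrix (UT K) (UT K) ℝ, BlkMaj cub cubn (normMat (L.op b u)) Km ∧
      ∀ y y', Km y y' ≤ lam * Real.exp (-(ρ * L.dist X b y y')))
    (hdiam : ∀ b, ∀ z ∈ L.dom b, ∀ z' ∈ L.dom b, tdist1 K z z' ≤ r) (hJ : ∀ b, (L.J b).card ≤ mJ)
    (hX : ∀ b, (L.J b).Nonempty → (L.dom b ∩ X).Nonempty)
    (hmult : ∀ z : UT K, (Finset.univ.filter fun b => L.anchor b = z).card ≤ nD) :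
    IsDomainLocalBD L c cub cubn X R lam ρ r mJ nD := by
  classical
  exact
  { hanchor := hanchor
    hsuppB := fun b u y y' hne => by
      obtain ⟨Km, hKm, h0⟩ := hmajS b u
      by_contra hc
      have hor : y ∉ L.dom b ∨ y' ∉ L.dom b := by
        by_cases hy : y ∈ L.dom b
        · exact Or.inr fun hy' => hc ⟨hy, hy'⟩
        · exact Or.inl hy
      exact hne (blockNorm_eq_zero_of_blkMaj cub cubn hKm (h0 y y' hor))
    han := han
    hbdBD := fun b u hu y y' => by
      obtain ⟨Km, hKm, hdom⟩ := hmajD b u hu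
      exact blockNorm_le_exp_of_blkMaj cub cubn hKm hdom y y'
    hdiam := hdiam
    hJ := hJ
    hX := hX
    hmult := hmult }

/-- Conversely the decaying block datum GIVES block-majorant data of both kinds (the bridge is lossless): the block-norm kernel
itself, truncated to `dom □ × dom □`, is a majorant. [folklore] -/
theorem blkMaj_of_isDomainLocalBD (hL : IsDomainLocalBD L c cub cubn X R lam ρ r mJ nD) (b : L.B) (u : E) :
    BlkMaj cub cubn (normMat (L.op b u)) (Matrix.of fun y y' => blockNorm cub cubn (L.op b u) y y') ∧
      (∀ y y', (y ∉ L.dom b ∨ y' ∉ L.dom b) → (Matrix.of fun y y' => blockNorm cub cubn (L.op b u) y y') y y' = 0) ∧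
      (u ∈ ball (0 : E) R → ∀ y y',
        (Matrix.of fun y y' => blockNorm cub cubn (L.op b u) y y') y y' ≤ lam * Real.exp (-(ρ * L.dist X b y y'))) := by
  refine ⟨blkMaj_of_blockNorm_le cub cubn (fun I J => blockNorm_nonneg cub cubn _ I J) (fun y y' => le_rfl), fun y y' hor => ?_,
    fun hu y y' => hL.hbdBD b u hu y y'⟩
  rw [Matrix.of_apply]
  by_contra hne
  rcases hor with hy | hy'
  · exact hy (hL.hsuppB b u y y' hne).1
  · exact hy' (hL.hsuppB b u y y' hne).2

end Constructor

/-! ## §4. Non-vacuity -/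

/-- NON-VACUITY of §1: the zero matrix has the zero majorant and block norm `0 ≤ 0`. -/
example (cub : p → UT K) (cubn : n → UT K) (y y' : UT K) :
    blockNorm cub cubn (0 : Matrix p n ℂ) y y' ≤ (0 : Matrix (UT K) (UT K) ℝ) y y' :=
  blockNorm_le_of_blkMaj cub cubn (T := 0)
    { nonneg := fun _ _ => le_rfl
      le := fun i J => by simp [normMat] } y y'

end Summit.QuantumFields.BalabanUV.Gaps.D4WalkBlockMajorantBridge

end
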